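/-
COR-CM (cells pub-hodgecm / pub-hodgecm2, stage 2 of the Hodge ladder) — TRANSPOSITION, item (vi) sub-binder S2, PINNING RECORD, REACH
HALF: TEAM hComp, row A0-DECITE (hA).  Seat hcomp-abcm-1 (gen 18); path under the pub-hodgecm2 lead's blanket for
`Transposition/HComp/<Name>.lean` (custody hcomp-lead).  THEOREMS ONLY: no definition, no instance, no named fact, no `variable`, no proof
holes.  Nothing in the tree is edited or restated: this file is the JOINTLY-EPIMORPHIC TWIN of pin-1's reach chain
(`Item6PinReach.lean` §1 `pinReach_of_componentPin`, `Item6PinReachAlong.lean` §1–§3, `Item6PinReachClosed.lean`), statement for statement,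
with the binder `hComp` ∕ `hAlb` re-typed from «product (limit fan)» to «jointly epimorphic family» — the only clause the proofs use — and
with pin-1's proofs copied token for token except at that one clause.  Offered to pin-1 ∕ the leads for the A0 decision (drop the binder
`hA : albanese_baseChange_isLimit_fan_jacobian` from the closed term); nothing here is consumed by the END display of record.
FRAMING: HC_CM is NOT proved; `hComp` stays a cited conditional on `exists_recordSystem`.
-/
import Summits.HodgeConjecture.CorCM.B01.Transposition.Item6PinReachAlong
import Summits.HodgeConjecture.CorCM.B01.Transposition.HComp.HUnifHolds
import Summits.HodgeConjecture.CorCM.B01.Transposition.HComp.HAlbEpiHolds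
import Summits.HodgeConjecture.CorCM.B01.Transposition.HComp.Sec42DataOf
import HarnessLib

/-!
# Item (vi) S2, the pinned REACH junction with a JOINTLY-EPIMORPHIC Albanese binder — `hA`-free closed form

pin-1's `Model.pinReach_of_componentPin` (`Transposition/Item6PinReach.lean`) derives own-htheta's `hReach` from (U1) `hcar` and the
READING binder (U3ᶜ) `hComp`: «`A_K ⊗_{E,ι₁} ℂ` is the PRODUCT (limit fan `π`) of the Albanese varieties `J(X_c)` of finitely many
ball-uniformised surfaces».  Its proof uses the product at ONE place: a non-zero `f : A_K ⊗ ℂ ⟶ A_μ` is non-zero on some factor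
(`CMReach.exists_inj_comp_ne_zero`).  Hence the weaker reading

  (U3ᵉ) «… Albanese data `𝒥 c` and homomorphisms `ι c : J(X_c) ⟶ A_K ⊗_{E,ι₁} ℂ` which are JOINTLY EPIMORPHIC:
         every non-zero `w : A_K ⊗ ℂ ⟶ T` has `ι c ≫ w ≠ 0` for some `c`»

suffices, with the same proof.  The point: TEAM hComp's split `hComp ⇐ hUnif + hAlb` (`Item6PinReachAlong.lean` §2) then needs `hAlb` only
in the jointly-epimorphic form, which is a THEOREM WITHOUT the named fact `Liu2021.albanese_baseChange_isLimit_fan_jacobian`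
(`HComp/HAlbEpiHolds.lean`, `Model.hAlbEpi_holds`, over `Liu2021/AlbaneseBaseChangeJointlyEpi.lean`).  Contents — pin-1's chain, twinned:

* §1 `Model.pinReach_of_componentPinEpi` — twin of `pinReach_of_componentPin` (generic complex pin; binders `hcar`, `hCompEpi`);
* §2 `Model.pinReach_of_componentPinC_alongEpi` — twin of `pinReach_of_componentPinC_along` (Appendix-C datum along `e ι₁`; `hcar`
  discharged; binder `hCompEpi`);
* §3 `Model.hCompEpi_of_unif_of_albEpi_along` — twin of `hComp_of_unif_of_alb_along` (`hCompEpi ⇐ hUnif + hAlbEpi`);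
* §4 `Model.pinReach_of_componentPinC_of_unif_of_albEpi_along` — the composite; its CONCLUSION is that of pin-1's
  `pinReach_of_componentPinC_of_unif_of_alb_along` VERBATIM, its binders are {`hUnif`, `hAlbEpi`};
* §5 `Model.hCompEpi_holds (h) (iso) (C) (R)` and `Model.pinReachEpi_closed (h₁) (h₃) (h) (iso) (C) (R)` — twins of
  `Item6PinReachClosed.lean`'s `hComp_holds` ∕ `pinReach_closed` with the binder `hA` GONE: `hUnif := hUnif_holds h` (pin-1,
  `HComp/HUnifHolds.lean`, from `h : exists_recordSystem`) and `hAlbEpi := hAlbEpi_holds_conj` (a theorem).  The conclusion of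
  `pinReachEpi_closed` is that of `pinReach_closed` VERBATIM; §6 = §5 at `C := Model.sec42DataOf h iso` (twins of `Item6PinReachClosedAtC0`).

So at the REACH junction the Albanese leaf carries NO cite; the Shimura leaf keeps its one cite `exists_recordSystem`.  HC_CM is NOT proved.
Citation scope of every tag below = that of the pin-1 declaration it twins (the derivations are pin-1's; the re-typing is ours).

References: Y. Liu, arXiv:2102.11518 (`FJcycle.tex`): Thm. 4.18 (1) l. 2239, §4.2 l. 2060–2066, Def. 4.5 (2) l. 1944, Prop. C.5
l. 4627–4637, §2.1 Proposition l. 1190–1200 and Lemma 2.4 (1); P. Deligne, *Variétés de Shimura* (Corvallis 1979) §2.1.2, 2.2.5, Cor. 2.7.21;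
U. Görtz, T. Wedhorn, *Algebraic Geometry I* Thm. 14.72 (1).
-/

noncomputable section

open scoped TensorProduct

namespace Summit.HodgeConjecture.CorCM.Model

open CategoryTheory CategoryTheory.Limits AlgebraicGeometry NumberField
open Literature.AlgebraicGeometry.Motives
open Literature.AlgebraicGeometry.HodgeTheory
open Literature.AlgebraicGeometry.ShimuraVarieties
open Literature.AlgebraicGeometry.ShimuraVarieties.UnitaryCanonicalModel
open Literature.NumberTheory.Automorphic
open Literature.NumberTheory.Automorphic.PicardCM
open Literature.NumberTheory.Automorphic.Liu2021
open Literature.NumberTheory.Automorphic.Liu2021.AppendixC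

/-! ## §1  Generic complex pin, jointly-epimorphic component presentation -/

/-- **`hReach` at a COMPONENT PIN, generic complex target, from a JOINTLY-EPIMORPHIC component presentation** — twin of pin-1's
`pinReach_of_componentPin` (`Item6PinReach.lean`): binders `hcar` (U1: a non-zero `φ ∈ Hom_E(A_K, A_μ)_ℚ` gives a non-zero complex
homomorphism `AKc … K ⟶ Aμ … D_μ`) and `hCompEpi` (U3ᵉ: below some open compact `Ksm`, Albanese data `𝒥 c` of finitely many
ball-uniformised `ℂ`-surfaces `X c` (Gram matrix `V.Hm^{ι₁}`, group `ι₁(Γ_c)`) with homomorphisms `ι c : J(X_c) ⟶ AKc … K` that are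
jointly epimorphic).  Proof = pin-1's: a non-zero `f` out of `AKc … K` is non-zero after some `ι c` (this replaces «non-zero on a factor
of the product»); the surface `X c` IS the tree's `P_{Γ_c}(V)` (`UnitaryBallModelUnique.exists_iso_of_eq`); Albanese transport
(`Jacobian.exists_hom_ne_zero_of_iso`).  HC_CM is NOT proved; `hcar`, `hCompEpi` are not inhabited here.  CITATION SCOPE as the twin's.
[cite: Liu2021, Thm. 4.18 (1) (FJcycle.tex l. 2239) and §4.2 l. 2066 (carriers `Hom_E(A_K, A_μ)_ℚ`, `A_K`)] -/
theorem pinReach_of_componentPinEpi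
    (h₁ : BallQuotientUniformised) (h₃ : CMAbelianVarietyRealised)
    (D : ∀ (F : CMField) (ι₁ : F →+* ℂ) (_ : HermSpace3 F ι₁) (_ : CMType F), Thm418Data (maximalRealSubfield F) F)
    (Aμ : ∀ (F : CMField) (ι₁ : F →+* ℂ) (V : HermSpace3 F ι₁) (Φ : CMType F), (D F ι₁ V Φ).Obj → AbelianVariety ℂ)
    (AKc : ∀ (F : CMField) (ι₁ : F →+* ℂ) (V : HermSpace3 F ι₁) (Φ : CMType F), Subgroup (D F ι₁ V Φ).G → AbelianVariety ℂ)
    (hcar : ∀ (F : CMField), IsGalois ℚ F → 6 ≤ Module.finrank ℚ F → ∀ (Φ : CMType F) (ι₁ : F →+* ℂ), ι₁ ∈ Φ.1 →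
      ∀ (V : HermSpace3 F ι₁) (K : Subgroup (D F ι₁ V Φ).G) (Dμ : (D F ι₁ V Φ).Obj) (φ : (D F ι₁ V Φ).HomK K Dμ),
        IsOpenCompact K → φ ≠ 0 → ∃ f : AKc F ι₁ V Φ K ⟶ Aμ F ι₁ V Φ Dμ, f ≠ 0)
    (hCompEpi : ∀ (F : CMField), IsGalois ℚ F → 6 ≤ Module.finrank ℚ F → ∀ (Φ : CMType F) (ι₁ : F →+* ℂ), ι₁ ∈ Φ.1 →
      ∀ V : HermSpace3 F ι₁, ∃ Ksm : Subgroup (D F ι₁ V Φ).G, IsOpenCompact Ksm ∧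
        ∀ K : Subgroup (D F ι₁ V Φ).G, IsOpenCompact K → K ≤ Ksm →
          ∃ (C : Type) (_ : Fintype C) (X : C → SchemeOver ℂ) (B : ∀ c, UnitaryBallUniformisationDatum 2 (X c))
            (Γ : C → Level V) (𝒥 : ∀ c, Jacobian (X c)) (ι : ∀ c, (𝒥 c).J ⟶ AKc F ι₁ V Φ K),
            (∀ c, (B c).Hℂ = V.Hm.map ι₁) ∧
            (∀ c, (B c).Γ.map (Matrix.GeneralLinearGroup.map (B c).τ₁) =
              (Γ c).Γ.map (Matrix.GeneralLinearGroup.map ι₁)) ∧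
            ∀ (T : AbelianVariety ℂ) (w : (AKc F ι₁ V Φ K) ⟶ T), w ≠ 0 → ∃ c, ι c ≫ w ≠ 0) :
    ∀ (F : CMField), IsGalois ℚ F → 6 ≤ Module.finrank ℚ F → ∀ (Φ : CMType F) (ι₁ : F →+* ℂ), ι₁ ∈ Φ.1 →
      ∀ V : HermSpace3 F ι₁, ∃ Ksm : Subgroup (D F ι₁ V Φ).G, IsOpenCompact Ksm ∧
        ∀ (K : Subgroup (D F ι₁ V Φ).G) (Dμ : (D F ι₁ V Φ).Obj) (φ : (D F ι₁ V Φ).HomK K Dμ),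
          IsOpenCompact K → K ≤ Ksm → φ ≠ 0 →
            ∃ (Γ : Level V) (𝒥 : Jacobian (Var.scheme (ballQuotientUniformisedDatum_of h₁) h₃ (.pms (pmsCode F ι₁ V Γ))))
              (w : 𝒥.J ⟶ Aμ F ι₁ V Φ Dμ), w ≠ 0 := by
  classical
  intro F hG h6 Φ ι₁ hι V
  obtain ⟨Ksm, hKsm, hcomp⟩ := hCompEpi F hG h6 Φ ι₁ hι V
  refine ⟨Ksm, hKsm, fun K Dμ φ hK hle hφ => ?_⟩
  -- (U1): a non-zero complex homomorphism `A_K ⊗ ℂ ⟶ Aμ Dμ`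
  obtain ⟨f, hf⟩ := hcar F hG h6 Φ ι₁ hι V K Dμ φ hK hφ
  -- (U3ᶜ): the component presentation at `K`
  obtain ⟨C, _, X, B, Γ, 𝒥, ι, hH, hΓ, hepi⟩ := hcomp K hK hle
  -- non-zero on some `Alb(X_c)` (joint epimorphy)
  obtain ⟨c, hs⟩ := hepi _ f hf
  -- the factor's surface is the tree's `P_{Γ_c}(V)`: model uniqueness for equal ball data
  have hF : 2 < Module.finrank ℚ F := by omega
  have han : (pmsCode F ι₁ V (Γ c)).IsAnisotropic := isAnisotropic_pmsCode_of_two_lt hF (Γ c)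
  set hU := ballQuotientUniformisedDatum_of h₁ with hU_def
  have hHc : (B c).Hℂ = (Var.ballDatum hU h₃ (pmsCode F ι₁ V (Γ c)) han).Hℂ := by
    rw [hH c]
    change V.Hm.map ι₁ = ((pmsRealisation hU _).datum han).H.map ((pmsRealisation hU _).datum han).E.subtype
    rw [(pmsRealisation hU (pmsCode F ι₁ V (Γ c))).datum_H han]
    exact (PicardCode.ofHermitian_H_map ι₁ V.Hm (Γ c).Γ V.isHermitian V.signature_ι₁ V.posDef_of_ne
      (Γ c).isCongruence (Γ c).torsionFree).symm
  have hΓc : (B c).Γ.map (Matrix.GeneralLinearGroup.map (B c).τ₁) =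
      (Var.ballDatum hU h₃ (pmsCode F ι₁ V (Γ c)) han).Γ.map
        (Matrix.GeneralLinearGroup.map (Var.ballDatum hU h₃ (pmsCode F ι₁ V (Γ c)) han).τ₁) := by
    rw [hΓ c]
    change _ = ((pmsRealisation hU _).datum han).Γ.map
      (Matrix.GeneralLinearGroup.map ((pmsRealisation hU _).datum han).E.subtype)
    rw [(pmsRealisation hU (pmsCode F ι₁ V (Γ c))).datum_Γ han]
    exact (PicardCode.ofHermitian_Γ_map ι₁ V.Hm (Γ c).Γ V.isHermitian V.signature_ι₁ V.posDef_of_ne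
      (Γ c).isCongruence (Γ c).torsionFree).symm
  obtain ⟨A₁, -⟩ := exists_isReal_hodgeModel_holds 2 (X c) (B c).isSmoothProjective
  obtain ⟨A₂, -⟩ := exists_isReal_hodgeModel_holds 2 _ (Var.ballDatum hU h₃ (pmsCode F ι₁ V (Γ c)) han).isSmoothProjective
  obtain ⟨e, -, -⟩ := UnitaryBallModelUnique.exists_iso_of_eq A₁ A₂ hHc hΓc
  -- transport the Albanese datum along `e`
  obtain ⟨𝒥', w, hw⟩ := (𝒥 c).exists_hom_ne_zero_of_iso e hs
  exact ⟨Γ c, 𝒥', w, hw⟩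

/-! ## §2  The Appendix-C datum along `e ι₁` -/

/-- **`hReach` at the APPENDIX-C DATUM along `e ι₁`, jointly-epimorphic reading** — twin of pin-1's `pinReach_of_componentPinC_along`
(`Item6PinReachAlong.lean` §1): carriers `P5`∕`iso`∕`C`∕`R`, pin embedding `e`, `hcar` DISCHARGED (`exists_ne_zero_of_tmul_ne_zero`,
`AbelianVariety.Hom.baseChange_ne_zero`), ONE binder `hCompEpi` = (U3ᵉ) read on `Alb_{X_K} ⊗_{E,e ι₁} ℂ`.  HC_CM is NOT proved;
`hCompEpi` is not inhabited here.  CITATION SCOPE as the twin's.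
[cite: Liu2021, Thm. 4.18 (1) (FJcycle.tex l. 2239), §4.2 l. 2066 and Def. 4.5 (2) l. 1944 (carriers `Hom_E(A_K, A_μ)_ℚ`, `A_K`, `A_μ`)]
[cite: GortzWedhorn2020, Theorem 14.72 (1)] -/
theorem pinReach_of_componentPinC_alongEpi
    (h₁ : BallQuotientUniformised) (h₃ : CMAbelianVarietyRealised)
    (e : ∀ (F : CMField), (F →+* ℂ) → (F →+* ℂ))
    (P5 : ∀ (F : CMField) (ι₁ : F →+* ℂ) (_ : HermSpace3 F ι₁) (_ : CMType F), PropC5Data (maximalRealSubfield F) F)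
    (iso : ∀ (F : CMField) (ι₁ : F →+* ℂ) (_ : HermSpace3 F ι₁) (_ : CMType F), ℕ → Prop)
    (C : ∀ (F : CMField) (ι₁ : F →+* ℂ) (V : HermSpace3 F ι₁) (Φ : CMType F), Sec42Data (P5 F ι₁ V Φ) (iso F ι₁ V Φ))
    (R : ∀ (F : CMField) (ι₁ : F →+* ℂ) (V : HermSpace3 F ι₁) (Φ : CMType F), Thm418Rest (C F ι₁ V Φ))
    (hCompEpi : ∀ (F : CMField), IsGalois ℚ F → 6 ≤ Module.finrank ℚ F → ∀ (Φ : CMType F) (ι₁ : F →+* ℂ), ι₁ ∈ Φ.1 →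
      ∀ V : HermSpace3 F ι₁, ∃ Ksm : Subgroup (toThm418Data (C F ι₁ V Φ) (R F ι₁ V Φ)).G, IsOpenCompact Ksm ∧
        ∀ K : Subgroup (toThm418Data (C F ι₁ V Φ) (R F ι₁ V Φ)).G, IsOpenCompact K → K ≤ Ksm →
          ∃ (Cset : Type) (_ : Fintype Cset) (X : Cset → SchemeOver ℂ) (B : ∀ c, UnitaryBallUniformisationDatum 2 (X c))
            (Γ : Cset → Level V) (𝒥 : ∀ c, Jacobian (X c))
            (ι : ∀ c, (𝒥 c).J ⟶ (letI := (e F ι₁).toAlgebra; ((C F ι₁ V Φ).A ((C F ι₁ V Φ).levelOf K)).baseChange ℂ)),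
            (∀ c, (B c).Hℂ = V.Hm.map ι₁) ∧
            (∀ c, (B c).Γ.map (Matrix.GeneralLinearGroup.map (B c).τ₁) =
              (Γ c).Γ.map (Matrix.GeneralLinearGroup.map ι₁)) ∧
            ∀ (T : AbelianVariety ℂ) (w : (letI := (e F ι₁).toAlgebra; ((C F ι₁ V Φ).A ((C F ι₁ V Φ).levelOf K)).baseChange ℂ) ⟶ T), w ≠ 0 → ∃ c, ι c ≫ w ≠ 0) :
    ∀ (F : CMField), IsGalois ℚ F → 6 ≤ Module.finrank ℚ F → ∀ (Φ : CMType F) (ι₁ : F →+* ℂ), ι₁ ∈ Φ.1 →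
      ∀ V : HermSpace3 F ι₁, ∃ Ksm : Subgroup (toThm418Data (C F ι₁ V Φ) (R F ι₁ V Φ)).G, IsOpenCompact Ksm ∧
        ∀ (K : Subgroup (toThm418Data (C F ι₁ V Φ) (R F ι₁ V Φ)).G) (Dμ : (toThm418Data (C F ι₁ V Φ) (R F ι₁ V Φ)).Obj)
          (φ : (toThm418Data (C F ι₁ V Φ) (R F ι₁ V Φ)).HomK K Dμ),
          IsOpenCompact K → K ≤ Ksm → φ ≠ 0 →
            ∃ (Γ : Level V) (𝒥 : Jacobian (Var.scheme (ballQuotientUniformisedDatum_of h₁) h₃ (.pms (pmsCode F ι₁ V Γ))))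
              (w : 𝒥.J ⟶ (letI := (e F ι₁).toAlgebra; ((R F ι₁ V Φ).Aμ Dμ).baseChange ℂ)), w ≠ 0 := by
  refine pinReach_of_componentPinEpi h₁ h₃ (fun F ι₁ V Φ => toThm418Data (C F ι₁ V Φ) (R F ι₁ V Φ))
    (fun F ι₁ V Φ Dμ => letI := (e F ι₁).toAlgebra; ((R F ι₁ V Φ).Aμ Dμ).baseChange ℂ)
    (fun F ι₁ V Φ K => letI := (e F ι₁).toAlgebra; ((C F ι₁ V Φ).A ((C F ι₁ V Φ).levelOf K)).baseChange ℂ) ?_ hCompEpi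
  intro F _ _ Φ ι₁ _ V K Dμ φ _ hφ
  letI := (e F ι₁).toAlgebra
  -- a non-zero `E`-homomorphism `A_{levelOf K} ⟶ A_μ D_μ` behind `φ ∈ ℚ ⊗ Hom`, non-zero after base change along `e ι₁`
  obtain ⟨f, hf⟩ := exists_ne_zero_of_tmul_ne_zero hφ
  exact ⟨AbelianVariety.Hom.baseChange ℂ f, AbelianVariety.Hom.baseChange_ne_zero ℂ hf⟩

/-! ## §3  `hCompEpi` split at the printed seams: `hUnif` + `hAlbEpi` -/

/-- **(U3ᵉ) along `e ι₁` DERIVED from `hUnif` + `hAlbEpi`** — twin of pin-1's `hComp_of_unif_of_alb_along` (`Item6PinReachAlong.lean` §2):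
`hUnif` VERBATIM (Deligne 1979 §2.1.2 on Liu's carrier `Sh(G(τ), h_{V(τ),e ι₁})_K`, pieces ball-uniformised by the tautological ball of
`V^{ι₁}`), and `hAlbEpi` = pin-1's `hAlb` with «product (limit fan)» re-typed «jointly epimorphic family `ι c : J(X_c) ⟶ Alb_{X_{K'}} ⊗ ℂ`»
— a THEOREM (`Model.hAlbEpi_holds`, `HComp/HAlbEpiHolds.lean`).  KERNEL = pin-1's (real place `τ` under `(e ι₁)|F⁺`, `Ksm := Ksm_unif ⊓ K₀`,
`levelOf K = K`, Compact Case `X_K = Sh(𝕍)_K`, Prop. C.5 at `τ' = e ι₁`, transport of the cofan), forwarding `𝒥, ι` and the joint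
epimorphy.  HC_CM is NOT proved; `hUnif`, `hAlbEpi` are not inhabited here.  CITATION SCOPE as the twin's.
[cite: Liu2021, Prop. C.5 (FJcycle.tex l. 4627–4637), App. C l. 4656, §4.2 l. 2060–2066, Def. 2.3 and the Proposition l. 1185–1200]
[cite: Deligne1979ShimuraVarieties, §2.1.2] -/
theorem hCompEpi_of_unif_of_albEpi_along
    (e : ∀ (F : CMField), (F →+* ℂ) → (F →+* ℂ))
    (P5 : ∀ (F : CMField) (ι₁ : F →+* ℂ) (_ : HermSpace3 F ι₁) (_ : CMType F), PropC5Data (maximalRealSubfield F) F)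
    (iso : ∀ (F : CMField) (ι₁ : F →+* ℂ) (_ : HermSpace3 F ι₁) (_ : CMType F), ℕ → Prop)
    (C : ∀ (F : CMField) (ι₁ : F →+* ℂ) (V : HermSpace3 F ι₁) (Φ : CMType F), Sec42Data (P5 F ι₁ V Φ) (iso F ι₁ V Φ))
    (hUnif : ∀ (F : CMField), IsGalois ℚ F → 6 ≤ Module.finrank ℚ F → ∀ (Φ : CMType F) (ι₁ : F →+* ℂ), ι₁ ∈ Φ.1 →
      ∀ (V : HermSpace3 F ι₁) (τ : maximalRealSubfield F →+* ℝ), C5.IsAbove τ (e F ι₁) →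
        ∃ Ksm : Subgroup (P5 F ι₁ V Φ).G, IsOpenCompact Ksm ∧
          ∀ K : C5.OpenCompactSubgroup (P5 F ι₁ V Φ).G, K.1 ≤ Ksm →
            ∃ (Cset : Type) (_ : Fintype Cset) (X : Cset → SchemeOver ℂ) (B : ∀ c, UnitaryBallUniformisationDatum 2 (X c))
              (Γ : Cset → Level V)
              (inj : ∀ c, X c ⟶ (baseChangeHom (e F ι₁).fieldRange.subtype).obj
                (((P5 F ι₁ V Φ).Sh τ (e F ι₁)).obj (C5.OpenCompactSubgroup.transport ((P5 F ι₁ V Φ).fix τ) K))),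
              (∀ c, (B c).Hℂ = V.Hm.map ι₁) ∧
              (∀ c, (B c).Γ.map (Matrix.GeneralLinearGroup.map (B c).τ₁) =
                (Γ c).Γ.map (Matrix.GeneralLinearGroup.map ι₁)) ∧
              Nonempty (IsColimit (Cofan.mk _ inj)))
    (hAlbEpi : ∀ (F : CMField), IsGalois ℚ F → 6 ≤ Module.finrank ℚ F → ∀ (Φ : CMType F) (ι₁ : F →+* ℂ), ι₁ ∈ Φ.1 →
      ∀ (V : HermSpace3 F ι₁) (K' : C5.SmallLevel (C F ι₁ V Φ).S.K₀) (Cset : Type) (_ : Fintype Cset) (X : Cset → SchemeOver ℂ)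
        (inj : ∀ c, X c ⟶ (baseChangeHom (e F ι₁)).obj ((C F ι₁ V Φ).X K')),
        (∀ c, IsSmoothProjective 2 (X c)) → Nonempty (IsColimit (Cofan.mk _ inj)) →
          ∃ (𝒥 : ∀ c, Jacobian (X c)) (ι : ∀ c, (𝒥 c).J ⟶ (letI := (e F ι₁).toAlgebra; ((C F ι₁ V Φ).A K').baseChange ℂ)),
            ∀ (T : AbelianVariety ℂ) (w : (letI := (e F ι₁).toAlgebra; ((C F ι₁ V Φ).A K').baseChange ℂ) ⟶ T), w ≠ 0 → ∃ c, ι c ≫ w ≠ 0) :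
    ∀ (F : CMField), IsGalois ℚ F → 6 ≤ Module.finrank ℚ F → ∀ (Φ : CMType F) (ι₁ : F →+* ℂ), ι₁ ∈ Φ.1 →
      ∀ V : HermSpace3 F ι₁, ∃ Ksm : Subgroup (C F ι₁ V Φ).G, IsOpenCompact Ksm ∧
        ∀ K : Subgroup (C F ι₁ V Φ).G, IsOpenCompact K → K ≤ Ksm →
          ∃ (Cset : Type) (_ : Fintype Cset) (X : Cset → SchemeOver ℂ) (B : ∀ c, UnitaryBallUniformisationDatum 2 (X c))
            (Γ : Cset → Level V) (𝒥 : ∀ c, Jacobian (X c))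
            (ι : ∀ c, (𝒥 c).J ⟶ (letI := (e F ι₁).toAlgebra; ((C F ι₁ V Φ).A ((C F ι₁ V Φ).levelOf K)).baseChange ℂ)),
            (∀ c, (B c).Hℂ = V.Hm.map ι₁) ∧
            (∀ c, (B c).Γ.map (Matrix.GeneralLinearGroup.map (B c).τ₁) =
              (Γ c).Γ.map (Matrix.GeneralLinearGroup.map ι₁)) ∧
            ∀ (T : AbelianVariety ℂ) (w : (letI := (e F ι₁).toAlgebra; ((C F ι₁ V Φ).A ((C F ι₁ V Φ).levelOf K)).baseChange ℂ) ⟶ T),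
              w ≠ 0 → ∃ c, ι c ≫ w ≠ 0 := by
  intro F hG h6 Φ ι₁ hι V
  -- the real embedding `τ` of `F⁺ = maximalRealSubfield F` under `e ι₁`
  have hreal : ComplexEmbedding.IsReal ((e F ι₁).comp (algebraMap (maximalRealSubfield F) F)) := by
    rw [ComplexEmbedding.isReal_iff]
    ext x
    rw [ComplexEmbedding.conjugate_coe_eq]
    exact (mem_maximalRealSubfield_iff (x : F)).1 x.2 (e F ι₁)
  set τ : maximalRealSubfield F →+* ℝ := hreal.embedding
  have hτ : C5.IsAbove τ (e F ι₁) := by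
    ext x
    simp [τ, ComplexEmbedding.IsReal.coe_embedding_apply]
  -- thresholds: `hUnif`'s `Ksm` and the system's `K₀`
  obtain ⟨KsmU, hKsmU, hunif⟩ := hUnif F hG h6 Φ ι₁ hι V τ hτ
  set K₀ := (C F ι₁ V Φ).S.K₀
  refine ⟨KsmU ⊓ K₀.1, ⟨?_, ?_⟩, fun K hK hle => ?_⟩
  · simpa only [Subgroup.coe_inf] using hKsmU.1.inter K₀.2.1
  · simpa only [Subgroup.coe_inf] using K₀.2.2.inter_left (Subgroup.isClosed_of_isOpen _ hKsmU.1)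
  have hleU : K ≤ KsmU := hle.trans inf_le_left
  have hle₀ : K ≤ K₀.1 := hle.trans inf_le_right
  -- the level `K' := levelOf K`, `= K` as a subgroup
  set K' : C5.SmallLevel K₀ := (C F ι₁ V Φ).levelOf K
  have hcoe : ((K'.1 : C5.OpenCompactSubgroup _) : Subgroup (C F ι₁ V Φ).G) = K := (C F ι₁ V Φ).coe_levelOf hK hle₀
  have hK'U : (K'.1 : Subgroup (C F ι₁ V Φ).G) ≤ KsmU := by rw [hcoe]; exact hleU
  -- `hUnif` at the level `K'` regarded in `G(τ)(𝔸^∞)`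
  obtain ⟨Cset, _, X, B, Γ, inj, hH, hΓ, ⟨hcol⟩⟩ := hunif K'.1 hK'U
  -- `d = [F⁺ : ℚ] > 1`: the Compact Case, `Sh(𝕍)_K` projective hence proper, `X_K = Sh(𝕍)_K`
  have hd : 1 < Module.finrank ℚ (maximalRealSubfield F) := by
    have hmul := Module.finrank_mul_finrank ℚ (maximalRealSubfield F) F
    rw [Algebra.IsQuadraticExtension.finrank_eq_two (maximalRealSubfield F) F] at hmul
    omega
  have hproj : IsProjectiveOver ((C F ι₁ V Φ).S.Sh𝕍.obj K') := (C F ι₁ V Φ).cpt.projective_Sh_of (Or.inl hd) K'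
  haveI : IsProper ((C F ι₁ V Φ).S.Sh𝕍.obj K').hom := hproj.isProper
  haveI : IsIso ((C F ι₁ V Φ).cpt.j.app K') := (C F ι₁ V Φ).cpt.isIso_j_of_isProper K' inferInstance
  -- `X_K ⊗_{E,e ι₁} ℂ ≅ Sh(G(τ), h_{V(τ),e ι₁})_{fix τ K} ⊗ ℂ`
  have hcomp : ((e F ι₁).fieldRange.subtype).comp (e F ι₁).rangeRestrictField = e F ι₁ := RingHom.ext fun _ => rfl
  let eX : (baseChangeHom (e F ι₁)).obj ((C F ι₁ V Φ).X K') ≅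
      (baseChangeHom (e F ι₁).fieldRange.subtype).obj
        (((P5 F ι₁ V Φ).Sh τ (e F ι₁)).obj (C5.OpenCompactSubgroup.transport ((P5 F ι₁ V Φ).fix τ) K'.1)) :=
    ((baseChangeHom (e F ι₁)).mapIso (asIso ((C F ι₁ V Φ).cpt.j.app K'))).symm ≪≫
      (baseChangeHomObjIsoOfComp (e F ι₁).rangeRestrictField (e F ι₁).fieldRange.subtype (e F ι₁) hcomp ((C F ι₁ V Φ).S.Sh𝕍.obj K')).symm ≪≫
      (baseChangeHom (e F ι₁).fieldRange.subtype).mapIso (((C F ι₁ V Φ).S.iso τ (e F ι₁) hτ).app K')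
  -- transport the coproduct decomposition to `X_K ⊗ ℂ`
  let inj' : ∀ c, X c ⟶ (baseChangeHom (e F ι₁)).obj ((C F ι₁ V Φ).X K') := fun c => inj c ≫ eX.inv
  have hcol' : Nonempty (IsColimit (Cofan.mk _ inj')) :=
    ⟨hcol.ofIsoColimit (Cofan.ext eX.symm (fun c => rfl))⟩
  -- Albanese: product decomposition of `Alb_{X_K} ⊗ ℂ`
  obtain ⟨𝒥, ι, hepi⟩ := hAlbEpi F hG h6 Φ ι₁ hι V K' Cset inferInstance X inj' (fun c => (B c).isSmoothProjective) hcol'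
  exact ⟨Cset, inferInstance, X, B, Γ, 𝒥, ι, hH, hΓ, hepi⟩

/-! ## §4  The composite along `e ι₁` from {`hUnif`, `hAlbEpi`} -/

/-- **`hReach` at the APPENDIX-C DATUM, pin `A_μ ⊗_{E,e ι₁} ℂ`, from {`hUnif`, `hAlbEpi`}** — twin of pin-1's
`pinReach_of_componentPinC_of_unif_of_alb_along` (`Item6PinReachAlong.lean` §3) = `pinReach_of_componentPinC_alongEpi ∘
hCompEpi_of_unif_of_albEpi_along`; the CONCLUSION is pin-1's VERBATIM.  HC_CM is NOT proved; `hUnif`, `hAlbEpi` are not inhabited here.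
[cite: Liu2021, Thm. 4.18 (1) (FJcycle.tex l. 2239), §4.2 l. 2060–2066, Def. 2.3, Def. 4.5 (2) l. 1944, Prop. C.5 l. 4627–4637, App. C l. 4656]
[cite: Deligne1979ShimuraVarieties, §2.1.2] -/
theorem pinReach_of_componentPinC_of_unif_of_albEpi_along
    (h₁ : BallQuotientUniformised) (h₃ : CMAbelianVarietyRealised)
    (e : ∀ (F : CMField), (F →+* ℂ) → (F →+* ℂ))
    (P5 : ∀ (F : CMField) (ι₁ : F →+* ℂ) (_ : HermSpace3 F ι₁) (_ : CMType F), PropC5Data (maximalRealSubfield F) F)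
    (iso : ∀ (F : CMField) (ι₁ : F →+* ℂ) (_ : HermSpace3 F ι₁) (_ : CMType F), ℕ → Prop)
    (C : ∀ (F : CMField) (ι₁ : F →+* ℂ) (V : HermSpace3 F ι₁) (Φ : CMType F), Sec42Data (P5 F ι₁ V Φ) (iso F ι₁ V Φ))
    (R : ∀ (F : CMField) (ι₁ : F →+* ℂ) (V : HermSpace3 F ι₁) (Φ : CMType F), Thm418Rest (C F ι₁ V Φ))
    (hUnif : ∀ (F : CMField), IsGalois ℚ F → 6 ≤ Module.finrank ℚ F → ∀ (Φ : CMType F) (ι₁ : F →+* ℂ), ι₁ ∈ Φ.1 →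
      ∀ (V : HermSpace3 F ι₁) (τ : maximalRealSubfield F →+* ℝ), C5.IsAbove τ (e F ι₁) →
        ∃ Ksm : Subgroup (P5 F ι₁ V Φ).G, IsOpenCompact Ksm ∧
          ∀ K : C5.OpenCompactSubgroup (P5 F ι₁ V Φ).G, K.1 ≤ Ksm →
            ∃ (Cset : Type) (_ : Fintype Cset) (X : Cset → SchemeOver ℂ) (B : ∀ c, UnitaryBallUniformisationDatum 2 (X c))
              (Γ : Cset → Level V)
              (inj : ∀ c, X c ⟶ (baseChangeHom (e F ι₁).fieldRange.subtype).obj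
                (((P5 F ι₁ V Φ).Sh τ (e F ι₁)).obj (C5.OpenCompactSubgroup.transport ((P5 F ι₁ V Φ).fix τ) K))),
              (∀ c, (B c).Hℂ = V.Hm.map ι₁) ∧
              (∀ c, (B c).Γ.map (Matrix.GeneralLinearGroup.map (B c).τ₁) =
                (Γ c).Γ.map (Matrix.GeneralLinearGroup.map ι₁)) ∧
              Nonempty (IsColimit (Cofan.mk _ inj)))
    (hAlbEpi : ∀ (F : CMField), IsGalois ℚ F → 6 ≤ Module.finrank ℚ F → ∀ (Φ : CMType F) (ι₁ : F →+* ℂ), ι₁ ∈ Φ.1 →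
      ∀ (V : HermSpace3 F ι₁) (K' : C5.SmallLevel (C F ι₁ V Φ).S.K₀) (Cset : Type) (_ : Fintype Cset) (X : Cset → SchemeOver ℂ)
        (inj : ∀ c, X c ⟶ (baseChangeHom (e F ι₁)).obj ((C F ι₁ V Φ).X K')),
        (∀ c, IsSmoothProjective 2 (X c)) → Nonempty (IsColimit (Cofan.mk _ inj)) →
          ∃ (𝒥 : ∀ c, Jacobian (X c)) (ι : ∀ c, (𝒥 c).J ⟶ (letI := (e F ι₁).toAlgebra; ((C F ι₁ V Φ).A K').baseChange ℂ)),
            ∀ (T : AbelianVariety ℂ) (w : (letI := (e F ι₁).toAlgebra; ((C F ι₁ V Φ).A K').baseChange ℂ) ⟶ T), w ≠ 0 → ∃ c, ι c ≫ w ≠ 0) :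
    ∀ (F : CMField), IsGalois ℚ F → 6 ≤ Module.finrank ℚ F → ∀ (Φ : CMType F) (ι₁ : F →+* ℂ), ι₁ ∈ Φ.1 →
      ∀ V : HermSpace3 F ι₁, ∃ Ksm : Subgroup (toThm418Data (C F ι₁ V Φ) (R F ι₁ V Φ)).G, IsOpenCompact Ksm ∧
        ∀ (K : Subgroup (toThm418Data (C F ι₁ V Φ) (R F ι₁ V Φ)).G) (Dμ : (toThm418Data (C F ι₁ V Φ) (R F ι₁ V Φ)).Obj)
          (φ : (toThm418Data (C F ι₁ V Φ) (R F ι₁ V Φ)).HomK K Dμ),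
          IsOpenCompact K → K ≤ Ksm → φ ≠ 0 →
            ∃ (Γ : Level V) (𝒥 : Jacobian (Var.scheme (ballQuotientUniformisedDatum_of h₁) h₃ (.pms (pmsCode F ι₁ V Γ))))
              (w : 𝒥.J ⟶ (letI := (e F ι₁).toAlgebra; ((R F ι₁ V Φ).Aμ Dμ).baseChange ℂ)), w ≠ 0 :=
  pinReach_of_componentPinC_alongEpi h₁ h₃ e P5 iso C R (hCompEpi_of_unif_of_albEpi_along e P5 iso C hUnif hAlbEpi)

/-! ## §5  CLOSED at the honest datum (package P2′: `e F ι₁ := (starRingEnd ℂ).comp ι₁`) — NO Albanese cite -/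

/-- **(U3ᵉ) `hCompEpi` HOLDS at the honest datum** — twin of `Item6PinReachClosed.lean`'s `hComp_holds` WITHOUT the binder `hA`:
`hCompEpi_of_unif_of_albEpi_along` at `e := conj ∘ ·`, `P5 := honestP5Of h`, fed with pin-1's THEOREM `hUnif_holds h` ([Deligne 1979]
2.2.5 + Cor. 2.7.21 behind the record `h : exists_recordSystem`; `HComp/HUnifHolds.lean`) and the THEOREM `hAlbEpi_holds_conj`
(`HComp/HAlbEpiHolds.lean`, no named fact).  Remaining cite: `exists_recordSystem` only.  HC_CM is NOT proved.
[cite: Deligne1979ShimuraVarieties, §2.1.2, 2.2.5 and Cor. 2.7.21] [cite: Liu2021, Prop. C.5 (FJcycle.tex l. 4627–4633), §4.2 l. 2060–2066, §2.1 Proposition l. 1190–1200] -/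
theorem hCompEpi_holds (h : exists_recordSystem)
    (iso : ∀ (F : CMField) (ι₁ : F →+* ℂ) (_ : HermSpace3 F ι₁) (_ : CMType F), ℕ → Prop)
    (C : ∀ (F : CMField) (ι₁ : F →+* ℂ) (V : HermSpace3 F ι₁) (Φ : CMType F), Sec42Data (honestP5Of h F ι₁ V Φ) (iso F ι₁ V Φ))
    (R : ∀ (F : CMField) (ι₁ : F →+* ℂ) (V : HermSpace3 F ι₁) (Φ : CMType F), Thm418Rest (C F ι₁ V Φ)) :
    ∀ (F : CMField), IsGalois ℚ F → 6 ≤ Module.finrank ℚ F → ∀ (Φ : CMType F) (ι₁ : F →+* ℂ), ι₁ ∈ Φ.1 →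
    ∀ V : HermSpace3 F ι₁, ∃ Ksm : Subgroup (toThm418Data (C F ι₁ V Φ) (R F ι₁ V Φ)).G, IsOpenCompact Ksm ∧
      ∀ K : Subgroup (toThm418Data (C F ι₁ V Φ) (R F ι₁ V Φ)).G, IsOpenCompact K → K ≤ Ksm →
        ∃ (Cset : Type) (_ : Fintype Cset) (X : Cset → SchemeOver ℂ) (B : ∀ c, UnitaryBallUniformisationDatum 2 (X c))
          (Γ : Cset → Level V) (𝒥 : ∀ c, Jacobian (X c))
          (ι : ∀ c, (𝒥 c).J ⟶ (letI := ((starRingEnd ℂ).comp ι₁).toAlgebra; ((C F ι₁ V Φ).A ((C F ι₁ V Φ).levelOf K)).baseChange ℂ)),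
          (∀ c, (B c).Hℂ = V.Hm.map ι₁) ∧
          (∀ c, (B c).Γ.map (Matrix.GeneralLinearGroup.map (B c).τ₁) =
            (Γ c).Γ.map (Matrix.GeneralLinearGroup.map ι₁)) ∧
          ∀ (T : AbelianVariety ℂ)
            (w : (letI := ((starRingEnd ℂ).comp ι₁).toAlgebra; ((C F ι₁ V Φ).A ((C F ι₁ V Φ).levelOf K)).baseChange ℂ) ⟶ T),
            w ≠ 0 → ∃ c, ι c ≫ w ≠ 0 :=
  hCompEpi_of_unif_of_albEpi_along (fun _ ι₁ => (starRingEnd ℂ).comp ι₁) (honestP5Of h) iso C (hUnif_holds h)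
    (hAlbEpi_holds_conj (honestP5Of h) iso C)

/-- **`hReach` CLOSED at the honest datum WITHOUT the Albanese cite** — twin of `Item6PinReachClosed.lean`'s `pinReach_closed` with the
binder `hA` GONE; the conclusion is `pinReach_closed`'s VERBATIM (own-htheta's `hReach` at `D := toThm418Data (C …) (R …)` over
`honestP5Of h`, pin `A_μ ⊗_{E,ῑ₁} ℂ`).  `pinReach_of_componentPinC_alongEpi ∘ hCompEpi_holds`.  Binders left: the record `h`
([Deligne 1979]), the consumer's posited carriers `iso`∕`C`∕`R` ([Liu2021] §4.2, Def. 4.5 (2)), the universe records `h₁`∕`h₃`.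
HC_CM is NOT proved.
[cite: Liu2021, Thm. 4.18 (1) (FJcycle.tex l. 2239), §4.2 l. 2060–2066, Def. 4.5 (2) l. 1944, Prop. C.5 l. 4627–4633, §2.1 Proposition l. 1190–1200]
[cite: Deligne1979ShimuraVarieties, §2.1.2, 2.2.5 and Cor. 2.7.21] -/
theorem pinReachEpi_closed
    (h₁ : BallQuotientUniformised) (h₃ : CMAbelianVarietyRealised) (h : exists_recordSystem)
    (iso : ∀ (F : CMField) (ι₁ : F →+* ℂ) (_ : HermSpace3 F ι₁) (_ : CMType F), ℕ → Prop)
    (C : ∀ (F : CMField) (ι₁ : F →+* ℂ) (V : HermSpace3 F ι₁) (Φ : CMType F), Sec42Data (honestP5Of h F ι₁ V Φ) (iso F ι₁ V Φ))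
    (R : ∀ (F : CMField) (ι₁ : F →+* ℂ) (V : HermSpace3 F ι₁) (Φ : CMType F), Thm418Rest (C F ι₁ V Φ)) :
    ∀ (F : CMField), IsGalois ℚ F → 6 ≤ Module.finrank ℚ F → ∀ (Φ : CMType F) (ι₁ : F →+* ℂ), ι₁ ∈ Φ.1 →
      ∀ V : HermSpace3 F ι₁, ∃ Ksm : Subgroup (toThm418Data (C F ι₁ V Φ) (R F ι₁ V Φ)).G, IsOpenCompact Ksm ∧
        ∀ (K : Subgroup (toThm418Data (C F ι₁ V Φ) (R F ι₁ V Φ)).G) (Dμ : (toThm418Data (C F ι₁ V Φ) (R F ι₁ V Φ)).Obj)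
          (φ : (toThm418Data (C F ι₁ V Φ) (R F ι₁ V Φ)).HomK K Dμ),
          IsOpenCompact K → K ≤ Ksm → φ ≠ 0 →
            ∃ (Γ : Level V) (𝒥 : Jacobian (Var.scheme (ballQuotientUniformisedDatum_of h₁) h₃ (.pms (pmsCode F ι₁ V Γ))))
              (w : 𝒥.J ⟶ (letI := ((starRingEnd ℂ).comp ι₁).toAlgebra; ((R F ι₁ V Φ).Aμ Dμ).baseChange ℂ)), w ≠ 0 :=
  pinReach_of_componentPinC_alongEpi h₁ h₃ (fun _ ι₁ => (starRingEnd ℂ).comp ι₁) (honestP5Of h) iso C R (hCompEpi_holds h iso C R)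

/-! ## §6  §5 AT THE CONSTRUCTED CARRIER `C := Model.sec42DataOf h iso` (twins of `Item6PinReachClosedAtC0.lean` p324734) -/
/-- **(U3ᵉ) `hCompEpi` at the honest datum WITH the §4.2 carrier INSTANTIATED, NO `hA`** — twin of `hComp_holds_atC0`:
`hCompEpi_holds h iso (sec42DataOf h iso) R` (pin-1's total term of `HComp/Sec42DataOf.lean`: at every face read, Prop. C.5's system on
Deligne's canonical models, Def. C.8 in the Compact Case, `A_K := Alb_{X_K}` from the THEOREM `Albanese.nonempty_of_numberField`).
Hypotheses left: the record `h`, the parameter `iso`, the rest `R`.  HC_CM is NOT proved. [cite: Deligne1979ShimuraVarieties, §2.1.2, 2.2.5 and Cor. 2.7.21] [cite: Liu2021, §2.1 Prop. 2.2 (FJcycle.tex l. 1190–1200), Def. 2.3 (l. 1202–1208), Prop. C.5 l. 4627–4633, §4.2 l. 2053–2074] -/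
theorem hCompEpi_holds_atC0 (h : exists_recordSystem)
    (iso : ∀ (F : CMField) (ι₁ : F →+* ℂ) (_ : HermSpace3 F ι₁) (_ : CMType F), ℕ → Prop)
    (R : ∀ (F : CMField) (ι₁ : F →+* ℂ) (V : HermSpace3 F ι₁) (Φ : CMType F), Thm418Rest (sec42DataOf h iso F ι₁ V Φ)) :
    ∀ (F : CMField), IsGalois ℚ F → 6 ≤ Module.finrank ℚ F → ∀ (Φ : CMType F) (ι₁ : F →+* ℂ), ι₁ ∈ Φ.1 →
    ∀ V : HermSpace3 F ι₁, ∃ Ksm : Subgroup (toThm418Data (sec42DataOf h iso F ι₁ V Φ) (R F ι₁ V Φ)).G, IsOpenCompact Ksm ∧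
      ∀ K : Subgroup (toThm418Data (sec42DataOf h iso F ι₁ V Φ) (R F ι₁ V Φ)).G, IsOpenCompact K → K ≤ Ksm →
        ∃ (Cset : Type) (_ : Fintype Cset) (X : Cset → SchemeOver ℂ) (B : ∀ c, UnitaryBallUniformisationDatum 2 (X c))
          (Γ : Cset → Level V) (𝒥 : ∀ c, Jacobian (X c))
          (ι : ∀ c, (𝒥 c).J ⟶ (letI := ((starRingEnd ℂ).comp ι₁).toAlgebra; ((sec42DataOf h iso F ι₁ V Φ).A ((sec42DataOf h iso F ι₁ V Φ).levelOf K)).baseChange ℂ)),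
          (∀ c, (B c).Hℂ = V.Hm.map ι₁) ∧
          (∀ c, (B c).Γ.map (Matrix.GeneralLinearGroup.map (B c).τ₁) = (Γ c).Γ.map (Matrix.GeneralLinearGroup.map ι₁)) ∧
          ∀ (T : AbelianVariety ℂ) (w : (letI := ((starRingEnd ℂ).comp ι₁).toAlgebra; ((sec42DataOf h iso F ι₁ V Φ).A ((sec42DataOf h iso F ι₁ V Φ).levelOf K)).baseChange ℂ) ⟶ T),
            w ≠ 0 → ∃ c, ι c ≫ w ≠ 0 :=
  hCompEpi_holds h iso (sec42DataOf h iso) R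

/-- **`hReach` CLOSED at the honest datum WITH the §4.2 carrier INSTANTIATED and WITHOUT the Albanese cite** — twin of
`pinReach_closed_atC0` with `hA` GONE, conclusion VERBATIM (own-htheta's `hReach` at `D := toThm418Data (sec42DataOf h iso …) (R …)`,
pin `A_μ ⊗_{E,ῑ₁} ℂ`): `pinReachEpi_closed h₁ h₃ h iso (sec42DataOf h iso) R`.  Binders left {h; iso, R; h₁, h₃}.  HC_CM is NOT proved.
[cite: Liu2021, Thm. 4.18 (1) (FJcycle.tex l. 2239), §4.2 l. 2053–2074, Def. 4.5 (2) l. 1944, Prop. C.5 l. 4627–4633, §2.1 Prop. 2.2 l. 1190–1200] [cite: Deligne1979ShimuraVarieties, §2.1.2, 2.2.5 and Cor. 2.7.21] -/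
theorem pinReachEpi_closed_atC0
    (h₁ : BallQuotientUniformised) (h₃ : CMAbelianVarietyRealised) (h : exists_recordSystem)
    (iso : ∀ (F : CMField) (ι₁ : F →+* ℂ) (_ : HermSpace3 F ι₁) (_ : CMType F), ℕ → Prop)
    (R : ∀ (F : CMField) (ι₁ : F →+* ℂ) (V : HermSpace3 F ι₁) (Φ : CMType F), Thm418Rest (sec42DataOf h iso F ι₁ V Φ)) :
    ∀ (F : CMField), IsGalois ℚ F → 6 ≤ Module.finrank ℚ F → ∀ (Φ : CMType F) (ι₁ : F →+* ℂ), ι₁ ∈ Φ.1 →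
      ∀ V : HermSpace3 F ι₁, ∃ Ksm : Subgroup (toThm418Data (sec42DataOf h iso F ι₁ V Φ) (R F ι₁ V Φ)).G, IsOpenCompact Ksm ∧
        ∀ (K : Subgroup (toThm418Data (sec42DataOf h iso F ι₁ V Φ) (R F ι₁ V Φ)).G) (Dμ : (toThm418Data (sec42DataOf h iso F ι₁ V Φ) (R F ι₁ V Φ)).Obj)
          (φ : (toThm418Data (sec42DataOf h iso F ι₁ V Φ) (R F ι₁ V Φ)).HomK K Dμ),
          IsOpenCompact K → K ≤ Ksm → φ ≠ 0 →
            ∃ (Γ : Level V) (𝒥 : Jacobian (Var.scheme (ballQuotientUniformisedDatum_of h₁) h₃ (.pms (pmsCode F ι₁ V Γ))))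
              (w : 𝒥.J ⟶ (letI := ((starRingEnd ℂ).comp ι₁).toAlgebra; ((R F ι₁ V Φ).Aμ Dμ).baseChange ℂ)), w ≠ 0 :=
  pinReachEpi_closed h₁ h₃ h iso (sec42DataOf h iso) R

end Summit.HodgeConjecture.CorCM.Model

end
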